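import Summits.QuantumFields.YangMills.Theorems.BalabanUVNodesN19ExpectationCurrency
import Literature.MathematicalPhysics.QuantumFieldTheory.Balaban1983to89.T4ApexVariance
import Summits.QuantumFields.BalabanUV.T4Continuum.Spine.NE7.Targets

/-!
# YM-DAG node N19 (= NE7 proper) — THE EXPECTATION CURRENCY OF THE NODE's DECL TARGET, II: AT THE SCHEME — matching modulo constants with
# remainder `δ_K` PAYS `|⟨∏os⟩_{K+1} − ⟨∏os⟩_K| ≤ 4·vol·δ_K∕l₀ + 2·√(vol·δ_K)`; hence `ExpectCauchyRate S (√δ)` and, when `Σ√δ_K < ∞`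
# (automatic for geometric remainders), the continuum limit of the expectations WITH AN EXPLICIT RATE; N19's `Spine.NE7.Target` and the
# apex's `StringwiseMatching` read in this currency

Cell `pub-ymgap`, HUMAN RULING D-0062 (Track A), R141 (C) wider-strategy seat `pub-ymgap-dag-n19-e` (strategy s3 = ALTERNATIVE CURRENCY); sibling of
the analysis module `…Theorems.BalabanUVNodesN19ExpectationCurrency` (Landau's inequality at the centre of a symmetric window; matched cgf increments
⇒ matched means at the price √), filed right after it.  Route `Summits/QuantumFields/YangMills/Theses/BalabanUVNodes.lean` rev 15, cluster item K3′
«SpineGivenEndpointR12» (stmt-QuantumFields-19908); filed `--supports` that item `--as helper` (it proves no registered stub).  COUNT-NEUTRAL: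
bookkeeping BY NAME over the tree's scheme objects (`T4GenFunBounds.schemeZ` ∕ `prodObs` ∕ `genFun_schemeZ_eq_cgf` ∕ `deriv_genFun_schemeZ_zero`,
`T4CauchySum.abs_genFun_succ_sub_le`, `T4VarianceMatching.ExpectCauchyRate` ∕ `hasContinuumLimit_of_expectCauchyRate`, `T4ApexVariance.StringwiseMatching`,
`Spine.NE7.Target`) + the sibling's analysis; NOT a discharge claim.

WHAT IS KERNEL-CHECKED (0 `def`, 0 `sorry`).
* §1 [folklore] `mul_nonneg_of_matchingModConstants` (`MatchingModConstants` forces `0 ≤ vol·δ_K`) · `summable_sqrt_of_le_geometric`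
  (`0 ≤ δ_K ≤ C·θ^K`, `θ < 1` ⇒ `Σ√δ_K < ∞`: the GEOMETRIC remainders of the budget road, module 1 p453434, pay a summable observable rate).
* §2 AT THE SCHEME [folklore + bookkeeping]: `abs_expectAt_succ_sub_le_of_matchingModConstants` — `MatchingModConstants vol l₀ δ (schemeZ S os)`,
  `0 < l₀` ⇒ `|S.expectAt (K+1) os − S.expectAt K os| ≤ 4·vol·δ_K∕l₀ + 2·√(vol·δ_K)` for EVERY `K` (the sibling's `abs_sub_deriv_cgf_zero_le` for
  the product observables `F_K`, `F_{K+1}` — bounded by `1` — under the two Gibbs measures, `η = 2·vol·δ_K`) ·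
  `expectCauchyRate_sqrt_of_matchingModConstants` (ONE remainder `δ` for all strings, `0 ≤ vol_os`, `vol_os·δ` bounded ⇒
  `T4VarianceMatching.ExpectCauchyRate S (√δ)`) · `hasContinuumLimit_of_matchingModConstants_sqrt` (`… ∧ Σ√δ_K < ∞ ⇒ Missing.HasContinuumLimit S`,
  BY NAME) · `abs_expectAt_sub_lim_le_of_matchingModConstants` (THE RATE: a limit `E` with `|S.expectAt K os − E| ≤ Σ_j d_{K+j}`,
  `d_K = 4·vol·δ_K∕l₀ + 2·√(vol·δ_K)`, whenever `Σ d_K < ∞` — Mathlib `dist_le_tsum_of_dist_le_of_tendsto`; what the Vitali road cannot give).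
* §3 N19 AND THE APEX BY NAME [bookkeeping]: `expectCauchyRate_sqrt_of_target` (`Spine.NE7.Target vol_os l₀ δ (schemeZ S os)` for every string with
  a COMMON remainder `δ` and `0 ≤ vol_os` ⇒ `ExpectCauchyRate S (√δ)` — boundedness of `vol·δ` is FREE from `Summable δ`) ·
  `stringwise_expectRate_of_stringwiseMatching` (the apex's per-string shape `T4ApexVariance.StringwiseMatching S` ⇒ per string a summable `δ`
  and the displayed increment bound at that string's own radius and volume factor).

HONEST FRAMING.  NE7 ∕ NE7b ∕ NE7c are NOT PRINTED ([Balaban1987RG1]–[Balaban1989LargeFieldII] bound ONE run uniformly in `ε`; printed template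
[King1986] (3.10)–(3.13) pp. 656–657, context only) and NOT PROVED; `Target` ∕ `MatchingModConstants` ∕ `StringwiseMatching` occur as HYPOTHESES
only; nothing of Bałaban's is asserted or instantiated; N19 is NOT discharged; Track A count unmoved (A 5∕28).  The summability `Σ√δ_K < ∞` is an
EXTRA hypothesis beyond `Target`'s `Σδ_K < ∞` (displayed, never smuggled): it holds for geometric remainders and fails for e.g. `δ_K = (K+1)⁻²`;
the qualitative limit needs only `Target` (node U0, unchanged); the price √ is sharp for the sibling's real-variable class (`sqrt_price_witness`) —
a linear observable rate from `Target` alone would need complex-variable input, NOT attempted.  One finite four-torus at fixed ε, rung (B)+1 —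
NOT infinite volume, NOT OS on ℝ⁴, NOT a mass gap, NOT Clay.  THEOREMS ONLY; 0 sorry; standard axioms.  No decl below carries a cite tag.
-/

set_option autoImplicit false

noncomputable section

open Set Filter Topology MeasureTheory ProbabilityTheory
open scoped BigOperators

namespace Summit.QuantumFields.YangMills.BalabanUVNodes.N19ExpectationCurrencyAtScheme

open Literature.MathematicalPhysics.QuantumFieldTheory.Balaban1983to89
open T4CauchySum (MatchingModConstants genFun)
open T4GenFunBounds (schemeZ prodObs)
open Missing (TorusScheme HasContinuumLimit)
open Summit.QuantumFields.BalabanUV.T4Continuum.Spine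
open Summit.QuantumFields.YangMills.BalabanUVNodes.N19ExpectationCurrency (abs_sub_deriv_cgf_zero_le)

/-! ## §1 Two arithmetic facts [folklore] -/

section Arith

/-- Under `MatchingModConstants` every `vol·δ_K` is non-negative (it dominates an absolute value at `t = 0`). [folklore] -/
theorem mul_nonneg_of_matchingModConstants {vol l₀ : ℝ} {δ : ℕ → ℝ} {Z : ℕ → ℝ → ℝ} (hl₀ : 0 ≤ l₀)
    (hM : MatchingModConstants vol l₀ δ Z) (K : ℕ) : 0 ≤ vol * δ K := by
  obtain ⟨c, hc⟩ := hM K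
  exact (abs_nonneg _).trans (hc 0 (by simpa using hl₀))

/-- `0 ≤ δ_K ≤ C·θ^K` with `0 ≤ θ < 1` ⇒ `Σ_K √δ_K < ∞` (`√δ_K ≤ √C·(√θ)^K`, a geometric series) — the GEOMETRIC remainders of the
budget road pay a summable observable rate. [folklore] -/
theorem summable_sqrt_of_le_geometric {δ : ℕ → ℝ} {C θ : ℝ} (hδ : ∀ K, 0 ≤ δ K) (hθ : 0 ≤ θ) (hθ1 : θ < 1)
    (hle : ∀ K, δ K ≤ C * θ ^ K) : Summable fun K => Real.sqrt (δ K) := by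
  have hC : 0 ≤ C := by
    have := (hδ 0).trans (hle 0)
    simpa using this
  have hθ' : Real.sqrt θ < 1 := (Real.sqrt_lt_sqrt hθ hθ1).trans_eq Real.sqrt_one
  have hθK : ∀ K : ℕ, Real.sqrt (θ ^ K) = Real.sqrt θ ^ K := fun K => by
    rw [Real.sqrt_eq_iff_mul_self_eq (pow_nonneg hθ K) (pow_nonneg (Real.sqrt_nonneg θ) K), ← mul_pow,
      Real.mul_self_sqrt hθ]
  refine Summable.of_nonneg_of_le (fun K => Real.sqrt_nonneg _) (fun K => ?_)
    ((summable_geometric_of_lt_one (Real.sqrt_nonneg θ) hθ').mul_left (Real.sqrt C))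
  calc Real.sqrt (δ K) ≤ Real.sqrt (C * θ ^ K) := Real.sqrt_le_sqrt (hle K)
    _ = Real.sqrt C * Real.sqrt θ ^ K := by rw [Real.sqrt_mul hC, hθK]

end Arith

/-! ## §2 At the scheme: N19's target in the observable currency [folklore + bookkeeping] -/

section Scheme

variable {G : Type*} [GaugeGroup G] [MeasurableSpace G] [RegularGaugeGroup G] [HaarData G] {O : Type*}
  (S : TorusScheme G O) (hβ : ∀ K, 0 ≤ S.β K) (hm : ∀ K o, Measurable (S.obs K o))
  (h1 : ∀ K o U, |S.obs K o U| ≤ 1)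
include hβ hm h1

/-- **N19's TARGET PAYS THE OBSERVABLE INCREMENTS AT THE PRICE √δ.**  If the dressed partition functions of a string `os` match modulo
constants with remainder `δ` at radius `l₀ > 0` (`T4CauchySum.MatchingModConstants vol l₀ δ (schemeZ S os)` — N19's DECL target without
its summability conjunct), then for every `K`
`|S.expectAt (K+1) os − S.expectAt K os| ≤ 4·vol·δ_K∕l₀ + 2·√(vol·δ_K)`:
§3 for the product observables `F_K`, `F_{K+1}` (bounded by `1`, `T4GenFunBounds.abs_prodObs_le_one`) under the two Gibbs measures, with
`genFun (schemeZ S os) K = cgf F_K` (`genFun_schemeZ_eq_cgf`), `(genFun …)′ 0 = S.expectAt K os` (`deriv_genFun_schemeZ_zero`) and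
`η = 2·vol·δ_K` (`T4CauchySum.abs_genFun_succ_sub_le`). [folklore] -/
theorem abs_expectAt_succ_sub_le_of_matchingModConstants {vol l₀ : ℝ} {δ : ℕ → ℝ} (hl₀ : 0 < l₀) (os : List O)
    (hM : MatchingModConstants vol l₀ δ (schemeZ S os)) (K : ℕ) :
    |S.expectAt (K + 1) os - S.expectAt K os| ≤ 4 * (vol * δ K) / l₀ + 2 * Real.sqrt (vol * δ K) := by
  haveI hP : ∀ K, IsProbabilityMeasure (T4GenFunBounds.gibbsMeasure (G := G) (S.P K) (S.β K)) := fun K =>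
    T4GenFunBounds.isProbabilityMeasure_gibbsMeasure (G := G) (S.P K) (hβ K)
  have hcgf : ∀ K, genFun (schemeZ S os) K =
      cgf (prodObs S K os) (T4GenFunBounds.gibbsMeasure (S.P K) (S.β K)) := fun K =>
    funext fun t => T4GenFunBounds.genFun_schemeZ_eq_cgf S hβ hm h1 K os t
  have hη : ∀ t ∈ Icc (-l₀) l₀,
      |(cgf (prodObs S (K + 1) os) (T4GenFunBounds.gibbsMeasure (S.P (K + 1)) (S.β (K + 1))) t -
          cgf (prodObs S (K + 1) os) (T4GenFunBounds.gibbsMeasure (S.P (K + 1)) (S.β (K + 1))) 0) -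
        (cgf (prodObs S K os) (T4GenFunBounds.gibbsMeasure (S.P K) (S.β K)) t -
          cgf (prodObs S K os) (T4GenFunBounds.gibbsMeasure (S.P K) (S.β K)) 0)| ≤ 2 * (vol * δ K) := by
    intro t ht
    have ht' : |t| ≤ l₀ := abs_le.mpr ht
    have h := T4CauchySum.abs_genFun_succ_sub_le hM hl₀.le K ht'
    have e : ∀ K, genFun (schemeZ S os) K t =
        cgf (prodObs S K os) (T4GenFunBounds.gibbsMeasure (S.P K) (S.β K)) t -
          cgf (prodObs S K os) (T4GenFunBounds.gibbsMeasure (S.P K) (S.β K)) 0 := fun K => by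
      rw [hcgf K, cgf_zero, sub_zero]
    rw [e (K + 1), e K] at h
    exact h
  have hmeas : ∀ K, AEMeasurable (prodObs S K os) (T4GenFunBounds.gibbsMeasure (S.P K) (S.β K)) := fun K =>
    (T4GenFunBounds.measurable_prodObs S hm K os).aemeasurable
  have hbd : ∀ K, ∀ᵐ U ∂(T4GenFunBounds.gibbsMeasure (G := G) (S.P K) (S.β K)), |prodObs S K os U| ≤ 1 := fun K =>
    Eventually.of_forall (T4GenFunBounds.abs_prodObs_le_one S h1 K os)
  have key := abs_sub_deriv_cgf_zero_le (hmeas K) (hbd K) (hmeas (K + 1)) (hbd (K + 1)) hl₀ hη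
  rw [← hcgf K, ← hcgf (K + 1), T4GenFunBounds.deriv_genFun_schemeZ_zero S hβ hm h1,
    T4GenFunBounds.deriv_genFun_schemeZ_zero S hβ hm h1] at key
  have e2 : Real.sqrt (2 * (2 * (vol * δ K)) * (1 : ℝ) ^ 2) = 2 * Real.sqrt (vol * δ K) := by
    rw [one_pow, mul_one, show (2 : ℝ) * (2 * (vol * δ K)) = 2 ^ 2 * (vol * δ K) by ring,
      Real.sqrt_mul (by norm_num) , Real.sqrt_sq (by norm_num)]
  rw [e2] at key
  have e3 : 2 * (2 * (vol * δ K)) / l₀ = 4 * (vol * δ K) / l₀ := by ring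
  rw [e3] at key
  exact key


/-- **ONE REMAINDER FOR ALL STRINGS ⇒ `ExpectCauchyRate S (√δ)`.**  If every string's dressed partition functions match modulo constants at
the common radius `l₀ > 0` with the COMMON remainder `δ`, a volume factor `vol_os ≥ 0`, and `vol_os·δ` bounded (by `D_os`), then
`T4VarianceMatching.ExpectCauchyRate S (√δ)` with the constant `C_os = (4·√D_os∕l₀ + 2)·√vol_os`
(`vol·δ_K = √(vol·δ_K)·√(vol·δ_K) ≤ √(vol·δ_K)·√D` and `√(vol·δ_K) = √vol·√δ_K`). [folklore] -/
theorem expectCauchyRate_sqrt_of_matchingModConstants {l₀ : ℝ} {δ : ℕ → ℝ} (hl₀ : 0 < l₀)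
    (hM : ∀ os : List O, ∃ vol D : ℝ, 0 ≤ vol ∧ (∀ K, vol * δ K ≤ D) ∧ MatchingModConstants vol l₀ δ (schemeZ S os)) :
    T4VarianceMatching.ExpectCauchyRate S fun K => Real.sqrt (δ K) := by
  intro os
  obtain ⟨vol, D, hvol, hD, hMos⟩ := hM os
  refine ⟨(4 * Real.sqrt D / l₀ + 2) * Real.sqrt vol, fun K => ?_⟩
  have hvd : 0 ≤ vol * δ K := mul_nonneg_of_matchingModConstants hl₀.le hMos K
  have h := abs_expectAt_succ_sub_le_of_matchingModConstants S hβ hm h1 hl₀ os hMos K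
  have hsq : vol * δ K ≤ Real.sqrt (vol * δ K) * Real.sqrt D :=
    calc vol * δ K = Real.sqrt (vol * δ K) * Real.sqrt (vol * δ K) := (Real.mul_self_sqrt hvd).symm
      _ ≤ Real.sqrt (vol * δ K) * Real.sqrt D :=
        mul_le_mul_of_nonneg_left (Real.sqrt_le_sqrt (hD K)) (Real.sqrt_nonneg _)
  have hsplit : Real.sqrt (vol * δ K) = Real.sqrt vol * Real.sqrt (δ K) := Real.sqrt_mul hvol _
  calc |S.expectAt (K + 1) os - S.expectAt K os| ≤ 4 * (vol * δ K) / l₀ + 2 * Real.sqrt (vol * δ K) := h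
    _ ≤ 4 * (Real.sqrt (vol * δ K) * Real.sqrt D) / l₀ + 2 * Real.sqrt (vol * δ K) := by gcongr
    _ = (4 * Real.sqrt D / l₀ + 2) * Real.sqrt vol * Real.sqrt (δ K) := by rw [hsplit]; ring

/-- **… AND `Σ√δ_K < ∞` ⇒ THE CONTINUUM LIMIT OF ALL JOINT EXPECTATIONS** (`T4VarianceMatching.hasContinuumLimit_of_expectCauchyRate` BY
NAME).  The extra summability is DISPLAYED: it holds for geometric remainders (`summable_sqrt_of_le_geometric`) and is NOT implied by
`Summable δ`. [folklore] -/
theorem hasContinuumLimit_of_matchingModConstants_sqrt {l₀ : ℝ} {δ : ℕ → ℝ} (hl₀ : 0 < l₀)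
    (hM : ∀ os : List O, ∃ vol D : ℝ, 0 ≤ vol ∧ (∀ K, vol * δ K ≤ D) ∧ MatchingModConstants vol l₀ δ (schemeZ S os))
    (hδ : Summable fun K => Real.sqrt (δ K)) : HasContinuumLimit S :=
  T4VarianceMatching.hasContinuumLimit_of_expectCauchyRate S hδ
    (expectCauchyRate_sqrt_of_matchingModConstants S hβ hm h1 hl₀ hM)

/-- **THE RATE TO THE LIMIT — WHAT THE VITALI ROAD CANNOT GIVE.**  Under `MatchingModConstants vol l₀ δ (schemeZ S os)` (`0 < l₀`), if the
displayed increments `d_K = 4·vol·δ_K∕l₀ + 2·√(vol·δ_K)` are summable, then the string's expectations converge to a limit `E` with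
`|S.expectAt K os − E| ≤ Σ_j d_{K+j}` for every `K` (Mathlib `cauchySeq_of_dist_le_of_summable` ∕ `dist_le_tsum_of_dist_le_of_tendsto`); for
geometric `δ_K ≤ C·θ^K` the tail is `O(θ^{K∕2})`. [folklore] -/
theorem abs_expectAt_sub_lim_le_of_matchingModConstants {vol l₀ : ℝ} {δ : ℕ → ℝ} (hl₀ : 0 < l₀) (os : List O)
    (hM : MatchingModConstants vol l₀ δ (schemeZ S os))
    (hs : Summable fun K => 4 * (vol * δ K) / l₀ + 2 * Real.sqrt (vol * δ K)) :
    ∃ E : ℝ, Tendsto (fun K => S.expectAt K os) atTop (𝓝 E) ∧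
      ∀ K, |S.expectAt K os - E| ≤ ∑' j, (4 * (vol * δ (K + j)) / l₀ + 2 * Real.sqrt (vol * δ (K + j))) := by
  have hd : ∀ K, dist (S.expectAt K os) (S.expectAt (K + 1) os) ≤
      (fun K => 4 * (vol * δ K) / l₀ + 2 * Real.sqrt (vol * δ K)) K := fun K => by
    rw [Real.dist_eq, abs_sub_comm]
    exact abs_expectAt_succ_sub_le_of_matchingModConstants S hβ hm h1 hl₀ os hM K
  have hc : CauchySeq fun K => S.expectAt K os := cauchySeq_of_dist_le_of_summable _ hd hs
  obtain ⟨E, hE⟩ := cauchySeq_tendsto_of_complete hc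
  exact ⟨E, hE, fun K => by
    rw [← Real.dist_eq]
    exact dist_le_tsum_of_dist_le_of_tendsto _ hd hs hE K⟩

/-! ## §3 N19's `Spine.NE7.Target` and the apex's `StringwiseMatching` in this currency [bookkeeping] -/

/-- **N19's DECL TARGET PAYS `ExpectCauchyRate S (√δ)`.**  If every string carries `Spine.NE7.Target vol_os l₀ δ (schemeZ S os)` (N19's DECL
target: matching modulo constants AND `Summable δ`) with a COMMON remainder `δ` at the common radius `l₀ > 0` and `0 ≤ vol_os`, then
`T4VarianceMatching.ExpectCauchyRate S (√δ)`: the bound `vol·δ_K ≤ Σ_j vol·δ_j` is FREE from the target's summability conjunct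
(`Summable.le_tsum`, terms `≥ 0` by `mul_nonneg_of_matchingModConstants`).  `Target` is a HYPOTHESIS (NOT PRINTED, NOT proved). [folklore] -/
theorem expectCauchyRate_sqrt_of_target {l₀ : ℝ} {δ : ℕ → ℝ} (hl₀ : 0 < l₀)
    (hT : ∀ os : List O, ∃ vol : ℝ, 0 ≤ vol ∧ NE7.Target vol l₀ δ (schemeZ S os)) :
    T4VarianceMatching.ExpectCauchyRate S fun K => Real.sqrt (δ K) := by
  refine expectCauchyRate_sqrt_of_matchingModConstants S hβ hm h1 hl₀ fun os => ?_
  obtain ⟨vol, hvol, hM, hsum⟩ := hT os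
  have hnn : ∀ K, 0 ≤ vol * δ K := mul_nonneg_of_matchingModConstants hl₀.le hM
  exact ⟨vol, ∑' K, vol * δ K, hvol, fun K => (hsum.mul_left vol).le_tsum K fun j _ => hnn j, hM⟩

/-- **THE APEX's PER-STRING SHAPE IN THIS CURRENCY.**  `T4ApexVariance.StringwiseMatching S` (every string matches modulo constants at ITS OWN
radius `l₀ > 0` and volume factor, with a summable remainder) hands, per string, a summable `δ` and the increment bound
`|S.expectAt (K+1) os − S.expectAt K os| ≤ 4·vol·δ_K∕l₀ + 2·√(vol·δ_K)` for every `K`.  (A scheme-uniform `ExpectCauchyRate` needs the common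
remainder of `expectCauchyRate_sqrt_of_matchingModConstants`; the per-string radii of `StringwiseMatching` need not be bounded below.)
`StringwiseMatching` is a HYPOTHESIS. [folklore] -/
theorem stringwise_expectRate_of_stringwiseMatching (h : T4ApexVariance.StringwiseMatching S) (os : List O) :
    ∃ (l₀ vol : ℝ) (δ : ℕ → ℝ), 0 < l₀ ∧ Summable δ ∧
      ∀ K, |S.expectAt (K + 1) os - S.expectAt K os| ≤ 4 * (vol * δ K) / l₀ + 2 * Real.sqrt (vol * δ K) := by
  obtain ⟨l₀, vol, δ, hl₀, hδ, hM⟩ := h os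
  exact ⟨l₀, vol, δ, hl₀, hδ, abs_expectAt_succ_sub_le_of_matchingModConstants S hβ hm h1 hl₀ os hM⟩

end Scheme

end Summit.QuantumFields.YangMills.BalabanUVNodes.N19ExpectationCurrencyAtScheme

end
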